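import Summits.HodgeConjecture.HodgeConjecture.Theorems.F0P3cStCharTSUpTrAssemblyCore   -- ★ (A1′)-E p852534 (this seat): §1 `inv_mul_sum_fib_eq_orbitSum`, §2 `orbitSum_comp_equiv` (+ ★ D, ★ (X1), ★ (N4), ★ WIF-H)
import HarnessLib

/-!
# F0 · P3c · ROAD «UP-TR» brick (A1′)-E′ «ASSEMBLY CORE, HAAR ON THE SYSTEM»: ★ E `upTransferLB_concrete_of_inputs` with the torus-measure Haar-ness asked only for `T ∈ SH`
# (Rogawski 1990 §12.5 pp. 182–183, Lemma 12.5.1)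

Cell `pub/hodgecm-mathlib`, crux H413 = `stmt-HodgeConjecture-24833` (lane `--supports … --as helper`); seat LH10-p01 (g8); ROAD «UP-TR» v2∕v3 (holder F0P3-p02 (g23)), brick (A1′)
«UP-TR ASSEMBLY», between FILE E and FILE F.  THEOREMS ONLY; sorry-free; no definition ∕ instance ∕ notation ∕ named fact; ★-only imports; axioms TRIO.

WHY.  ★ E takes the compact-core-normalised torus measures as a TOTAL family `tH : ∀ T : Subgroup H_v, Measure ↥T` with the instance binder `[∀ T, (tH T).IsHaarMeasure]`.
That instance is NOT constructible at FILE F: a subgroup `T ≤ H_v` that is not closed (e.g. a dense cyclic subgroup of the compact factor `U(Φ₁)(L⁺_v)`) is countable and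
non-discrete in the subspace topology, so `↥T` carries no left-invariant Borel measure that is positive on opens and finite on compacts.  E uses the instance only at
`T ∈ SH` (inside the per-`T` step, for ★ (A1′)-D `integrableOn_and_setIntegral_comp_embedding` ∕ `setIntegral_mul_orbitSum_embedding_eq`).  `upTransferLB_concrete_of_inputs_haarOn`
is E with that binder replaced by the hypothesis `htHh : ∀ T ∈ SH, (tH T).IsHaarMeasure` — every other token of the statement unchanged (so the (F2)…(F5) discharges, which
are stated against E's binder TYPES, apply verbatim) — and E's proof with one `haveI := htHh T hT` in the per-`T` step.  FILE F defines `tH T` by choice on `SH` (★ (E3)-type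
existence at `T = Z_H(γ₀)`) and `0` elsewhere, and discharges `htHh`∕`htH` by `dif_pos`.
HONEST LABEL: count-neutral; UP-TR block consequents move only at the rider editions; organs 2 = 2; h413 registry untouched; print's general-α clause 3 is NOT claimed in house;
HC_CM is proved only modulo the printed citations until rung 0 closes.

## References
* [Rogawski1990] J. D. Rogawski, *Automorphic Representations of Unitary Groups in Three Variables*, Ann. of Math. Stud. 123 (1990), §12.5 pp. 182–183 (the display defining
  `α ↦ α^G`; Lemma 12.5.1 and its six-line proof), §4.9 p. 55, §4.3 (4.3.1) p. 43.
* [LanglandsShelstad1987] R. P. Langlands, D. Shelstad, *On the definition of transfer factors*, Math. Ann. 278 (1987), §1.3.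
-/

set_option autoImplicit false
-- the mandated namespace has the single-problem summit's repeated segment (`HodgeConjecture.HodgeConjecture`)
set_option linter.dupNamespace false

noncomputable section

open MeasureTheory Measure Set Filter Topology Function NumberField IsDedekindDomain Matrix
open Literature.MeasureTheory.Group
open Literature.NumberTheory.Automorphic Literature.NumberTheory.Automorphic.UnitaryGroup Literature.NumberTheory.Rogawski1990
open Literature.NumberTheory.GaloisRepresentations
open Summit.HodgeConjecture.HodgeConjecture.Cruxes.H413
open Summit.HodgeConjecture.HodgeConjecture.Cruxes.H413.F0P3cStCharTSWeylCartanRadial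
open Summit.HodgeConjecture.HodgeConjecture.Cruxes.H413.F0P3cStCharTSWeylHypMeasure
open Summit.HodgeConjecture.HodgeConjecture.Cruxes.H413.F0P3cStCharTSUpTrTubeSocketAnyCartan
open Summit.HodgeConjecture.HodgeConjecture.Cruxes.H413.F0P3cStCharTSUpTrExchange
open Summit.HodgeConjecture.HodgeConjecture.Cruxes.H413.F0P3cStCharTSUpTrRegularLoc
open scoped ENNReal NNReal MatrixGroups Pointwise Classical
open Summit.HodgeConjecture.HodgeConjecture.Cruxes.H413.F0P3cStCharTSUpTrAssemblyCore

namespace Summit.HodgeConjecture.HodgeConjecture.Cruxes.H413.F0P3cStCharTSUpTrAssemblyCoreSH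

section CM

variable (L : Type) [Field L] [NumberField L] [IsCMField L] (v : HeightOneSpectrum (𝓞 ↥(maximalRealSubfield L)))

/-! ## The assembly from named inputs, Haar-ness on `SH` only -/

set_option maxHeartbeats 3200000 in
set_option synthInstance.maxHeartbeats 400000 in
-- long statement; instance-term unification on the CM local carriers (class of ★ (N4) ∕ ★ (P3))
/-- **(A1′)-E′ «UP-TR ASSEMBLY FROM NAMED INPUTS», Haar-ness of the torus measures asked ONLY on the system `SH` (`htHh : ∀ T ∈ SH, (tH T).IsHaarMeasure`) — the
instantiable form of ★ E `upTransferLB_concrete_of_inputs` (same statement otherwise, token for token; same proof with one `haveI`).**  `G = U(Φ₃)(L⁺_v)`, `H_v = U(Φ₂) × U(Φ₁)`, `v` non-split; `νQv` Haar, `mQv` canonical; `dG`, `dH` ABSTRACT closed forms (`dG` a class function with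
`√(∏_w|disc|·(∏_w|det|)⁻²) = dG²` on the regular set).  INPUTS BY SHAPE (ROAD v2 §A letters): the `H`-Cartan system `SH` with weights `cW`, per `T ∈ SH` the embeddings
`e T i : T ≃ₜ* Z_G(γ T i)` (`γ T i` regular, pointwise matching `he`, `ψ T i = e T i` on `T`) and the finite fibres `fib g T i` ((X2) from ★ (N2b′)); THE compact-core-normalised Haar
measures `tH T`; (A-2) `hP3` = ★ (P3) `finsum_upSummand_eq_weightedSum`'s conclusion; (A0) the piece integrability `hIntG` (group side) and `hIntT` (torus side, on `T`); (A-4) `hP2` =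
(P2)'s per-point fold + transfer `Σ_i dG(e_i s)·τ(s)·dH(s)·κ(s, e_i s)·α(s)·Φ_G([e_i s], f) = dH(s)²·α(s)·Φ^st_H(s, f^H)`; (A-5) `hSW` = (H6b′) SWIFH's conclusion.  THEN
**`∫_G f(g) · α^G(g) dνQv(g) = ∫_H f^H(h) · α(h) dνHv(h)`** with `α^G` spelled by (UP-DEF): `α^G(g) = 𝟙[g regular] · dG(g)⁻¹ · Σ_{q} 𝟙[q G-regular, q ↔ g] τ(q) dH(q) κ(q,g) α(q)`.
[cite: Rogawski1990, §12.5 pp. 182–183, Lemma 12.5.1] [cite: LanglandsShelstad1987, §1.3] -/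
theorem upTransferLB_concrete_of_inputs_haarOn
    (hns : ∀ w : PlacesOver L v, IsCMField.complexConj L • w.1 = w.1)
    [MeasurableSpace (Gqs L v)] [BorelSpace (Gqs L v)] [LocallyCompactSpace (Gqs L v)] [SecondCountableTopology (Gqs L v)] [T2Space (Gqs L v)]
    [∀ γ' : Gqs L v, MeasurableSpace (Gqs L v ⧸ Subgroup.centralizer ({γ'} : Set (Gqs L v)))]
    [∀ γ' : Gqs L v, BorelSpace (Gqs L v ⧸ Subgroup.centralizer ({γ'} : Set (Gqs L v)))]
    [MeasurableSpace (Gqs L v ⧸ Subgroup.center (Gqs L v))]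
    [MeasurableSpace ((UnitaryGroup.cmDatum L 2 (Matrix.of fun i j : Fin 2 => if i.val + j.val + 1 = 2 then (1 : L) else 0)).Local v × (UnitaryGroup.cmDatum L 1 (Matrix.of fun i j : Fin 1 => if i.val + j.val + 1 = 1 then (1 : L) else 0)).Local v)] [BorelSpace ((UnitaryGroup.cmDatum L 2 (Matrix.of fun i j : Fin 2 => if i.val + j.val + 1 = 2 then (1 : L) else 0)).Local v × (UnitaryGroup.cmDatum L 1 (Matrix.of fun i j : Fin 1 => if i.val + j.val + 1 = 1 then (1 : L) else 0)).Local v)]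
    [∀ a : ((UnitaryGroup.cmDatum L 2 (Matrix.of fun i j : Fin 2 => if i.val + j.val + 1 = 2 then (1 : L) else 0)).Local v × (UnitaryGroup.cmDatum L 1 (Matrix.of fun i j : Fin 1 => if i.val + j.val + 1 = 1 then (1 : L) else 0)).Local v), MeasurableSpace (((UnitaryGroup.cmDatum L 2 (Matrix.of fun i j : Fin 2 => if i.val + j.val + 1 = 2 then (1 : L) else 0)).Local v × (UnitaryGroup.cmDatum L 1 (Matrix.of fun i j : Fin 1 => if i.val + j.val + 1 = 1 then (1 : L) else 0)).Local v) ⧸ Subgroup.centralizer ({a} : Set ((UnitaryGroup.cmDatum L 2 (Matrix.of fun i j : Fin 2 => if i.val + j.val + 1 = 2 then (1 : L) else 0)).Local v × (UnitaryGroup.cmDatum L 1 (Matrix.of fun i j : Fin 1 => if i.val + j.val + 1 = 1 then (1 : L) else 0)).Local v)))]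
    (νHv : Measure ((UnitaryGroup.cmDatum L 2 (Matrix.of fun i j : Fin 2 => if i.val + j.val + 1 = 2 then (1 : L) else 0)).Local v × (UnitaryGroup.cmDatum L 1 (Matrix.of fun i j : Fin 1 => if i.val + j.val + 1 = 1 then (1 : L) else 0)).Local v)) (νQv : Measure (Gqs L v)) [νQv.IsHaarMeasure] [νQv.IsMulRightInvariant]
    (mHv : OrbitalMeasureFamily ((UnitaryGroup.cmDatum L 2 (Matrix.of fun i j : Fin 2 => if i.val + j.val + 1 = 2 then (1 : L) else 0)).Local v × (UnitaryGroup.cmDatum L 1 (Matrix.of fun i j : Fin 1 => if i.val + j.val + 1 = 1 then (1 : L) else 0)).Local v)) {mQv : OrbitalMeasureFamily (Gqs L v)}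
    (hcanQ : mQv.IsCanonical (fun γ' => IsRegularElt (γ'.val : GL (Fin 3) (UnitaryGroup.LocalRing L v))) νQv)
    (μ : HeckeCharacter L)
    -- the closed forms, abstract
    (dG : Gqs L v → ℝ) (hdG : ∀ h g : Gqs L v, dG (h * g * h⁻¹) = dG g)
    (hdGsq : ∀ t : Gqs L v, IsRegularElt (t.val : GL (Fin 3) (UnitaryGroup.LocalRing L v)) → ((NNReal.sqrt ((∏ w : PlacesOver L v, IsNonarchimedeanLocalField.normAbs (w.1.adicCompletion L) ((((t).val : GL (Fin 3) (UnitaryGroup.LocalRing L v)).val.charpoly.discr) w)) * ((∏ w : PlacesOver L v, IsNonarchimedeanLocalField.normAbs (w.1.adicCompletion L) ((((t).val : GL (Fin 3) (UnitaryGroup.LocalRing L v)).val.det) w)) ^ 2)⁻¹) : ℝ≥0) : ℝ) = dG t * dG t)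
    (dH : ((UnitaryGroup.cmDatum L 2 (Matrix.of fun i j : Fin 2 => if i.val + j.val + 1 = 2 then (1 : L) else 0)).Local v × (UnitaryGroup.cmDatum L 1 (Matrix.of fun i j : Fin 1 => if i.val + j.val + 1 = 1 then (1 : L) else 0)).Local v) → ℝ)
    -- the `H`-Cartan system, weights, embeddings, fibres ((H1) ∕ (H6a′) ∕ (X2) letters, BY SHAPE)
    (SH : Finset (Subgroup ((UnitaryGroup.cmDatum L 2 (Matrix.of fun i j : Fin 2 => if i.val + j.val + 1 = 2 then (1 : L) else 0)).Local v × (UnitaryGroup.cmDatum L 1 (Matrix.of fun i j : Fin 1 => if i.val + j.val + 1 = 1 then (1 : L) else 0)).Local v))) (cW : Subgroup ((UnitaryGroup.cmDatum L 2 (Matrix.of fun i j : Fin 2 => if i.val + j.val + 1 = 2 then (1 : L) else 0)).Local v × (UnitaryGroup.cmDatum L 1 (Matrix.of fun i j : Fin 1 => if i.val + j.val + 1 = 1 then (1 : L) else 0)).Local v) → ℂ) (n : Subgroup ((UnitaryGroup.cmDatum L 2 (Matrix.of fun i j : Fin 2 => if i.val + j.val + 1 = 2 then (1 : L) else 0)).Local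 v × (UnitaryGroup.cmDatum L 1 (Matrix.of fun i j : Fin 1 => if i.val + j.val + 1 = 1 then (1 : L) else 0)).Local v) → ℕ)
    (γc : (T : Subgroup ((UnitaryGroup.cmDatum L 2 (Matrix.of fun i j : Fin 2 => if i.val + j.val + 1 = 2 then (1 : L) else 0)).Local v × (UnitaryGroup.cmDatum L 1 (Matrix.of fun i j : Fin 1 => if i.val + j.val + 1 = 1 then (1 : L) else 0)).Local v)) → Fin (n T) → Gqs L v) (hγc : ∀ T ∈ SH, ∀ i : Fin (n T), IsRegularElt ((γc T i).val : GL (Fin 3) (UnitaryGroup.LocalRing L v)))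
    (eT : (T : Subgroup ((UnitaryGroup.cmDatum L 2 (Matrix.of fun i j : Fin 2 => if i.val + j.val + 1 = 2 then (1 : L) else 0)).Local v × (UnitaryGroup.cmDatum L 1 (Matrix.of fun i j : Fin 1 => if i.val + j.val + 1 = 1 then (1 : L) else 0)).Local v)) → (i : Fin (n T)) → (↥T ≃ₜ* ↥(Subgroup.centralizer ({γc T i} : Set (Gqs L v)))))
    (heT : ∀ T ∈ SH, ∀ (i : Fin (n T)) (s : ↥T), IsLocalNormPair L (qsForm L) v s.1 ((eT T i s : ↥(Subgroup.centralizer ({γc T i} : Set (Gqs L v)))) : Gqs L v))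
    (ψ : (T : Subgroup ((UnitaryGroup.cmDatum L 2 (Matrix.of fun i j : Fin 2 => if i.val + j.val + 1 = 2 then (1 : L) else 0)).Local v × (UnitaryGroup.cmDatum L 1 (Matrix.of fun i j : Fin 1 => if i.val + j.val + 1 = 1 then (1 : L) else 0)).Local v)) → Fin (n T) → ((UnitaryGroup.cmDatum L 2 (Matrix.of fun i j : Fin 2 => if i.val + j.val + 1 = 2 then (1 : L) else 0)).Local v × (UnitaryGroup.cmDatum L 1 (Matrix.of fun i j : Fin 1 => if i.val + j.val + 1 = 1 then (1 : L) else 0)).Local v) → Gqs L v) (hψ : ∀ T ∈ SH, ∀ (i : Fin (n T)) (s : ↥T), ψ T i s.1 = ((eT T i s : ↥(Subgroup.centralizer ({γc T i} : Set (Gqs L v)))) : Gqs L v))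
    (fib : Gqs L v → (T : Subgroup ((UnitaryGroup.cmDatum L 2 (Matrix.of fun i j : Fin 2 => if i.val + j.val + 1 = 2 then (1 : L) else 0)).Local v × (UnitaryGroup.cmDatum L 1 (Matrix.of fun i j : Fin 1 => if i.val + j.val + 1 = 1 then (1 : L) else 0)).Local v)) → Fin (n T) → Finset ((UnitaryGroup.cmDatum L 2 (Matrix.of fun i j : Fin 2 => if i.val + j.val + 1 = 2 then (1 : L) else 0)).Local v × (UnitaryGroup.cmDatum L 1 (Matrix.of fun i j : Fin 1 => if i.val + j.val + 1 = 1 then (1 : L) else 0)).Local v))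
    (hfib : ∀ g : Gqs L v, ∀ T ∈ SH, ∀ (i : Fin (n T)) (x : ((UnitaryGroup.cmDatum L 2 (Matrix.of fun i j : Fin 2 => if i.val + j.val + 1 = 2 then (1 : L) else 0)).Local v × (UnitaryGroup.cmDatum L 1 (Matrix.of fun i j : Fin 1 => if i.val + j.val + 1 = 1 then (1 : L) else 0)).Local v)), x ∈ fib g T i ↔ x ∈ T ∧ IsLocalGRegular L v x ∧ IsConj (ψ T i x) g)
    (tH : (T : Subgroup ((UnitaryGroup.cmDatum L 2 (Matrix.of fun i j : Fin 2 => if i.val + j.val + 1 = 2 then (1 : L) else 0)).Local v × (UnitaryGroup.cmDatum L 1 (Matrix.of fun i j : Fin 1 => if i.val + j.val + 1 = 1 then (1 : L) else 0)).Local v)) → Measure ↥T) (htHh : ∀ T ∈ SH, (tH T).IsHaarMeasure) (htH : ∀ T ∈ SH, tH T (compactCore ↥T) = 1)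
    -- the analytic data
    (α : ((UnitaryGroup.cmDatum L 2 (Matrix.of fun i j : Fin 2 => if i.val + j.val + 1 = 2 then (1 : L) else 0)).Local v × (UnitaryGroup.cmDatum L 1 (Matrix.of fun i j : Fin 1 => if i.val + j.val + 1 = 1 then (1 : L) else 0)).Local v) → ℂ) (f : Gqs L v → ℂ) (hf : Measurable f) (fH : ((UnitaryGroup.cmDatum L 2 (Matrix.of fun i j : Fin 2 => if i.val + j.val + 1 = 2 then (1 : L) else 0)).Local v × (UnitaryGroup.cmDatum L 1 (Matrix.of fun i j : Fin 1 => if i.val + j.val + 1 = 1 then (1 : L) else 0)).Local v) → ℂ)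
    -- (A-2): ★ (P3) CLAIM-P's conclusion
    (hP3 : ∀ g : Gqs L v, IsRegularElt (g.val : GL (Fin 3) (UnitaryGroup.LocalRing L v)) →
      (∑ᶠ q : Quot (IsLocalStablyConjH L v),
              (if IsLocalGRegular L v q.out ∧ IsLocalNormPair L (qsForm L) v q.out g then
                finTau L v q.out μ * (dH q.out : ℂ) * ((finKappaAt L v (qsForm L) q.out g : ℤ) : ℂ) * α q.out
              else 0)) =
        ∑ T ∈ SH, cW T * ∑ i : Fin (n T), ∑ x ∈ fib g T i, finTau L v x μ * (dH x : ℂ) * ((finKappaAt L v (qsForm L) x g : ℤ) : ℂ) * α x)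
    -- (A0)(iii): the `(T, i)`-pieces are integrable on `G`
    (hIntG : ∀ T ∈ SH, ∀ i : Fin (n T), Integrable (fun y : Gqs L v => f y *
      ∑ᶠ s : ↥T, {s' : ↥T | IsConj (((eT T i s' : ↥(Subgroup.centralizer ({γc T i} : Set (Gqs L v)))) : Gqs L v)) y}.indicator (fun s : ↥T => (if IsRegularElt ((((eT T i s : ↥(Subgroup.centralizer ({γc T i} : Set (Gqs L v)))) : Gqs L v)).val : GL (Fin 3) (UnitaryGroup.LocalRing L v)) then ((dG ((eT T i s : ↥(Subgroup.centralizer ({γc T i} : Set (Gqs L v)))) : Gqs L v) : ℂ))⁻¹ else 0) * (finTau L v s.1 μ * (dH s.1 : ℂ) * ((finKappaAt L v (qsForm L) s.1 ((eT T i s : ↥(Subgroup.centralizer ({γc T i} : Set (Gqs L v)))) : Gqs L v) : ℤ) : ℂ) * α s.1)) s) νQv)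
    -- (A0)(ii): the torus-side pieces are integrable on `T^{G-reg}`
    (hIntT : ∀ T ∈ SH, ∀ i : Fin (n T), IntegrableOn (fun s : ↥T => ((NNReal.sqrt ((∏ w : PlacesOver L v, IsNonarchimedeanLocalField.normAbs (w.1.adicCompletion L) ((((((eT T i s : ↥(Subgroup.centralizer ({γc T i} : Set (Gqs L v)))) : Gqs L v)).val : GL (Fin 3) (UnitaryGroup.LocalRing L v)).val.charpoly.discr) w)) * ((∏ w : PlacesOver L v, IsNonarchimedeanLocalField.normAbs (w.1.adicCompletion L) ((((((eT T i s : ↥(Subgroup.centralizer ({γc T i} : Set (Gqs L v)))) : Gqs L v)).val : GL (Fin 3) (UnitaryGroup.LocalRing L v)).val.det) w)) ^ 2)⁻¹) : ℝ≥0) : ℝ) •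
      ((fun s : ↥T => (if IsRegularElt ((((eT T i s : ↥(Subgroup.centralizer ({γc T i} : Set (Gqs L v)))) : Gqs L v)).val : GL (Fin 3) (UnitaryGroup.LocalRing L v)) then ((dG ((eT T i s : ↥(Subgroup.centralizer ({γc T i} : Set (Gqs L v)))) : Gqs L v) : ℂ))⁻¹ else 0) * (finTau L v s.1 μ * (dH s.1 : ℂ) * ((finKappaAt L v (qsForm L) s.1 ((eT T i s : ↥(Subgroup.centralizer ({γc T i} : Set (Gqs L v)))) : Gqs L v) : ℤ) : ℂ) * α s.1)) s * classOrbitalIntegral mQv f (ConjClasses.mk ((eT T i s : ↥(Subgroup.centralizer ({γc T i} : Set (Gqs L v)))) : Gqs L v)))) {s : ↥T | IsLocalGRegular L v (s : ((UnitaryGroup.cmDatum L 2 (Matrix.of fun i j : Fin 2 => if i.val + j.val + 1 = 2 then (1 : L) else 0)).Local v × (UnitaryGroup.cmDatum L 1 (Matrix.of fun i j : Fin 1 => if i.val + j.val + 1 = 1 then (1 : L) else 0)).Local v))} (tH T))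
    -- (A-4): (P2)'s fold + transfer side, per `G`-regular `s ∈ T`
    (hP2 : ∀ T ∈ SH, ∀ s : ↥T, IsLocalGRegular L v (s : ((UnitaryGroup.cmDatum L 2 (Matrix.of fun i j : Fin 2 => if i.val + j.val + 1 = 2 then (1 : L) else 0)).Local v × (UnitaryGroup.cmDatum L 1 (Matrix.of fun i j : Fin 1 => if i.val + j.val + 1 = 1 then (1 : L) else 0)).Local v)) →
      ∑ i : Fin (n T), (dG ((eT T i s : ↥(Subgroup.centralizer ({γc T i} : Set (Gqs L v)))) : Gqs L v) : ℂ) * (finTau L v s.1 μ * (dH s.1 : ℂ) * ((finKappaAt L v (qsForm L) s.1 ((eT T i s : ↥(Subgroup.centralizer ({γc T i} : Set (Gqs L v)))) : Gqs L v) : ℤ) : ℂ) * α s.1) *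
          classOrbitalIntegral mQv f (ConjClasses.mk ((eT T i s : ↥(Subgroup.centralizer ({γc T i} : Set (Gqs L v)))) : Gqs L v)) =
        ((dH s.1 : ℂ) ^ 2) * α s.1 * stableOrbitalIntegralRel (IsLocalStablyConjH L v) mHv fH s.1)
    -- (A-5): (H6b′) SWIFH's conclusion with the weights `cW`
    (hSW : ∑ T ∈ SH, cW T * ∫ s in {s : ↥T | IsLocalGRegular L v (s : ((UnitaryGroup.cmDatum L 2 (Matrix.of fun i j : Fin 2 => if i.val + j.val + 1 = 2 then (1 : L) else 0)).Local v × (UnitaryGroup.cmDatum L 1 (Matrix.of fun i j : Fin 1 => if i.val + j.val + 1 = 1 then (1 : L) else 0)).Local v))}, ((dH s.1 : ℂ) ^ 2) * α s.1 * stableOrbitalIntegralRel (IsLocalStablyConjH L v) mHv fH s.1 ∂(tH T) =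
      ∫ h, fH h * α h ∂νHv) :
    ∫ g, f g *
        (if IsRegularElt (g.val : GL (Fin 3) (UnitaryGroup.LocalRing L v)) then
          ((dG g : ℂ))⁻¹ * ∑ᶠ q : Quot (IsLocalStablyConjH L v),
              (if IsLocalGRegular L v q.out ∧ IsLocalNormPair L (qsForm L) v q.out g then
                finTau L v q.out μ * (dH q.out : ℂ) * ((finKappaAt L v (qsForm L) q.out g : ℤ) : ℂ) * α q.out
              else 0)
        else 0) ∂νQv = ∫ h, fH h * α h ∂νHv := by
  -- ### (A-1) localise to the regular set (★ (X1))
  rw [integral_mul_ite_isRegularElt_eq_setIntegral_mul L v hns νQv f]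
  have hGm : MeasurableSet {g : Gqs L v | IsRegularElt (g.val : GL (Fin 3) (UnitaryGroup.LocalRing L v))} := measurableSet_setOf_isRegularElt L v hns
  -- ### (A-2) pointwise on the regular set: (P3) + §1
  have hpt : ∀ g ∈ {g : Gqs L v | IsRegularElt (g.val : GL (Fin 3) (UnitaryGroup.LocalRing L v))},
      f g * (((dG g : ℂ))⁻¹ * ∑ᶠ q : Quot (IsLocalStablyConjH L v),
              (if IsLocalGRegular L v q.out ∧ IsLocalNormPair L (qsForm L) v q.out g then
                finTau L v q.out μ * (dH q.out : ℂ) * ((finKappaAt L v (qsForm L) q.out g : ℤ) : ℂ) * α q.out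
              else 0)) =
        ∑ T ∈ SH, ∑ i : Fin (n T), cW T * (f g *
          ∑ᶠ s : ↥T, {s' : ↥T | IsConj (((eT T i s' : ↥(Subgroup.centralizer ({γc T i} : Set (Gqs L v)))) : Gqs L v)) g}.indicator (fun s : ↥T => (if IsRegularElt ((((eT T i s : ↥(Subgroup.centralizer ({γc T i} : Set (Gqs L v)))) : Gqs L v)).val : GL (Fin 3) (UnitaryGroup.LocalRing L v)) then ((dG ((eT T i s : ↥(Subgroup.centralizer ({γc T i} : Set (Gqs L v)))) : Gqs L v) : ℂ))⁻¹ else 0) * (finTau L v s.1 μ * (dH s.1 : ℂ) * ((finKappaAt L v (qsForm L) s.1 ((eT T i s : ↥(Subgroup.centralizer ({γc T i} : Set (Gqs L v)))) : Gqs L v) : ℤ) : ℂ) * α s.1)) s) := by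
    intro g hg
    rw [Set.mem_setOf_eq] at hg
    rw [hP3 g hg, Finset.mul_sum, Finset.mul_sum]
    refine Finset.sum_congr rfl fun T hT => ?_
    rw [show f g * (((dG g : ℂ))⁻¹ * (cW T * ∑ i : Fin (n T), ∑ x ∈ fib g T i, finTau L v x μ * (dH x : ℂ) * ((finKappaAt L v (qsForm L) x g : ℤ) : ℂ) * α x)) =
        ∑ i : Fin (n T), cW T * (f g * (((dG g : ℂ))⁻¹ * ∑ x ∈ fib g T i, finTau L v x μ * (dH x : ℂ) * ((finKappaAt L v (qsForm L) x g : ℤ) : ℂ) * α x)) by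
      rw [Finset.mul_sum, Finset.mul_sum, Finset.mul_sum]
      exact Finset.sum_congr rfl fun i _ => by ring]
    refine Finset.sum_congr rfl fun i _ => ?_
    rw [inv_mul_sum_fib_eq_orbitSum L v μ dG hdG dH α (eT T i) (heT T hT i) (ψ T i) (hψ T hT i) g hg (fib g T i) (hfib g T hT i)]
  rw [setIntegral_congr_fun hGm hpt]
  -- ### (A-3) linearity over `(T, i)`
  have hIntG' : ∀ T ∈ SH, ∀ i : Fin (n T), Integrable (fun y : Gqs L v => cW T * (f y *
      ∑ᶠ s : ↥T, {s' : ↥T | IsConj (((eT T i s' : ↥(Subgroup.centralizer ({γc T i} : Set (Gqs L v)))) : Gqs L v)) y}.indicator (fun s : ↥T => (if IsRegularElt ((((eT T i s : ↥(Subgroup.centralizer ({γc T i} : Set (Gqs L v)))) : Gqs L v)).val : GL (Fin 3) (UnitaryGroup.LocalRing L v)) then ((dG ((eT T i s : ↥(Subgroup.centralizer ({γc T i} : Set (Gqs L v)))) : Gqs L v) : ℂ))⁻¹ else 0) * (finTau L v s.1 μ * (dH s.1 : ℂ) * ((finKappaAt L v (qsForm L) s.1 ((eT T i s : ↥(Subgroup.centralizer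 ({γc T i} : Set (Gqs L v)))) : Gqs L v) : ℤ) : ℂ) * α s.1)) s))
      (νQv.restrict {g : Gqs L v | IsRegularElt (g.val : GL (Fin 3) (UnitaryGroup.LocalRing L v))}) :=
    fun T hT i => ((hIntG T hT i).const_mul (cW T)).restrict
  rw [integral_finsetSum SH fun T hT => integrable_finsetSum _ fun i _ => hIntG' T hT i]
  rw [← hSW]
  refine Finset.sum_congr rfl fun T hT => ?_
  haveI : (tH T).IsHaarMeasure := htHh T hT
  rw [integral_finsetSum _ fun i _ => hIntG' T hT i]
  simp_rw [integral_const_mul]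
  rw [← Finset.mul_sum]
  congr 1
  -- ### per `(T, i)`: ★ (X1) to the `T′`-regular set, ★ (A1′)-D EXCHANGE, then the pointwise weight identity
  have hTm : MeasurableSet {s : ↥T | IsLocalGRegular L v (s : ((UnitaryGroup.cmDatum L 2 (Matrix.of fun i j : Fin 2 => if i.val + j.val + 1 = 2 then (1 : L) else 0)).Local v × (UnitaryGroup.cmDatum L 1 (Matrix.of fun i j : Fin 1 => if i.val + j.val + 1 = 1 then (1 : L) else 0)).Local v))} := F0P3cStCharTSUpTrWIFH.measurableSet_setOf_isLocalGRegular_subtype hns T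
  have hpiece : ∀ i : Fin (n T),
      ∫ y in {g : Gqs L v | IsRegularElt (g.val : GL (Fin 3) (UnitaryGroup.LocalRing L v))}, f y *
          ∑ᶠ s : ↥T, {s' : ↥T | IsConj (((eT T i s' : ↥(Subgroup.centralizer ({γc T i} : Set (Gqs L v)))) : Gqs L v)) y}.indicator (fun s : ↥T => (if IsRegularElt ((((eT T i s : ↥(Subgroup.centralizer ({γc T i} : Set (Gqs L v)))) : Gqs L v)).val : GL (Fin 3) (UnitaryGroup.LocalRing L v)) then ((dG ((eT T i s : ↥(Subgroup.centralizer ({γc T i} : Set (Gqs L v)))) : Gqs L v) : ℂ))⁻¹ else 0) * (finTau L v s.1 μ * (dH s.1 : ℂ) * ((finKappaAt L v (qsForm L) s.1 ((eT T i s : ↥(Subgroup.centralizer ({γc T i} : Set (Gqs L v)))) : Gqs L v) : ℤ) : ℂ) * α s.1)) s ∂νQv =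
        ∫ s in {s : ↥T | IsLocalGRegular L v (s : ((UnitaryGroup.cmDatum L 2 (Matrix.of fun i j : Fin 2 => if i.val + j.val + 1 = 2 then (1 : L) else 0)).Local v × (UnitaryGroup.cmDatum L 1 (Matrix.of fun i j : Fin 1 => if i.val + j.val + 1 = 1 then (1 : L) else 0)).Local v))}, (dG ((eT T i s : ↥(Subgroup.centralizer ({γc T i} : Set (Gqs L v)))) : Gqs L v) : ℂ) * (finTau L v s.1 μ * (dH s.1 : ℂ) * ((finKappaAt L v (qsForm L) s.1 ((eT T i s : ↥(Subgroup.centralizer ({γc T i} : Set (Gqs L v)))) : Gqs L v) : ℤ) : ℂ) * α s.1) *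
          classOrbitalIntegral mQv f (ConjClasses.mk ((eT T i s : ↥(Subgroup.centralizer ({γc T i} : Set (Gqs L v)))) : Gqs L v)) ∂(tH T) ∧
      IntegrableOn (fun s : ↥T => (dG ((eT T i s : ↥(Subgroup.centralizer ({γc T i} : Set (Gqs L v)))) : Gqs L v) : ℂ) * (finTau L v s.1 μ * (dH s.1 : ℂ) * ((finKappaAt L v (qsForm L) s.1 ((eT T i s : ↥(Subgroup.centralizer ({γc T i} : Set (Gqs L v)))) : Gqs L v) : ℤ) : ℂ) * α s.1) *
          classOrbitalIntegral mQv f (ConjClasses.mk ((eT T i s : ↥(Subgroup.centralizer ({γc T i} : Set (Gqs L v)))) : Gqs L v))) {s : ↥T | IsLocalGRegular L v (s : ((UnitaryGroup.cmDatum L 2 (Matrix.of fun i j : Fin 2 => if i.val + j.val + 1 = 2 then (1 : L) else 0)).Local v × (UnitaryGroup.cmDatum L 1 (Matrix.of fun i j : Fin 1 => if i.val + j.val + 1 = 1 then (1 : L) else 0)).Local v))} (tH T) := by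
    intro i
    -- the `G`-Cartan `T′ = Z_G(γ T i)`, its Borel quotient σ-algebra and its compact-core-normalised Haar measure (★ (E3))
    letI : MeasurableSpace (Gqs L v ⧸ Subgroup.centralizer ({γc T i} : Set (Gqs L v))) := borel _
    haveI : BorelSpace (Gqs L v ⧸ Subgroup.centralizer ({γc T i} : Set (Gqs L v))) := ⟨rfl⟩
    obtain ⟨tT, htTh, htTi, htT1⟩ := F0P3cStCharTSWeylCartanOrbInt.exists_haar_cartan_compactCore_eq_one (hγc T hT i) (rfl : Subgroup.centralizer ({γc T i} : Set (Gqs L v)) = _)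
    haveI := htTh
    haveI := htTi
    -- `K` on `T′`, read back on `T` it is `K′`
    set K : ↥(Subgroup.centralizer ({γc T i} : Set (Gqs L v))) → ℂ := fun t => (fun s : ↥T => (if IsRegularElt ((((eT T i s : ↥(Subgroup.centralizer ({γc T i} : Set (Gqs L v)))) : Gqs L v)).val : GL (Fin 3) (UnitaryGroup.LocalRing L v)) then ((dG ((eT T i s : ↥(Subgroup.centralizer ({γc T i} : Set (Gqs L v)))) : Gqs L v) : ℂ))⁻¹ else 0) * (finTau L v s.1 μ * (dH s.1 : ℂ) * ((finKappaAt L v (qsForm L) s.1 ((eT T i s : ↥(Subgroup.centralizer ({γc T i} : Set (Gqs L v)))) : Gqs L v) : ℤ) : ℂ) * α s.1)) ((eT T i).symm t) with hKdef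
    have hKe : ∀ s : ↥T, K (eT T i s) = (fun s : ↥T => (if IsRegularElt ((((eT T i s : ↥(Subgroup.centralizer ({γc T i} : Set (Gqs L v)))) : Gqs L v)).val : GL (Fin 3) (UnitaryGroup.LocalRing L v)) then ((dG ((eT T i s : ↥(Subgroup.centralizer ({γc T i} : Set (Gqs L v)))) : Gqs L v) : ℂ))⁻¹ else 0) * (finTau L v s.1 μ * (dH s.1 : ℂ) * ((finKappaAt L v (qsForm L) s.1 ((eT T i s : ↥(Subgroup.centralizer ({γc T i} : Set (Gqs L v)))) : Gqs L v) : ℤ) : ℂ) * α s.1)) s := fun s => by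
      simp only [hKdef, ContinuousMulEquiv.symm_apply_apply]
    -- the orbit sum re-indexed on `T′`
    have horb : ∀ y : Gqs L v,
        (∑ᶠ s : ↥T, {s' : ↥T | IsConj (((eT T i s' : ↥(Subgroup.centralizer ({γc T i} : Set (Gqs L v)))) : Gqs L v)) y}.indicator (fun s : ↥T => (if IsRegularElt ((((eT T i s : ↥(Subgroup.centralizer ({γc T i} : Set (Gqs L v)))) : Gqs L v)).val : GL (Fin 3) (UnitaryGroup.LocalRing L v)) then ((dG ((eT T i s : ↥(Subgroup.centralizer ({γc T i} : Set (Gqs L v)))) : Gqs L v) : ℂ))⁻¹ else 0) * (finTau L v s.1 μ * (dH s.1 : ℂ) * ((finKappaAt L v (qsForm L) s.1 ((eT T i s : ↥(Subgroup.centralizer ({γc T i} : Set (Gqs L v)))) : Gqs L v) : ℤ) : ℂ) * α s.1)) s) =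
          ∑ᶠ t : ↥(Subgroup.centralizer ({γc T i} : Set (Gqs L v))), {t' : ↥(Subgroup.centralizer ({γc T i} : Set (Gqs L v))) | IsConj ((t' : Gqs L v)) y}.indicator K t := by
      intro y
      rw [← orbitSum_comp_equiv L v (eT T i) K y]
      exact finsum_congr fun s => by simp only [hKe]
    -- ★ (X1): the orbit sum of `T′` lives on `G_{T′}`
    have hloc := setIntegral_mul_orbitSum_setOf_isRegularElt_eq_cartanSet L v hns νQv (Subgroup.centralizer ({γc T i} : Set (Gqs L v))) f K
    -- integrability inputs of ★ (A1′)-D in its letters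
    -- a conjugation family of the abelian `T′` (for the Borel-ness of `G_{T′}`, ★ `measurableSet_cartanSet`)
    obtain ⟨Φ', hΦ'⟩ := exists_conjFamily (Subgroup.centralizer ({γc T i} : Set (Gqs L v)))
      (mul_comm_cartan (hγc T hT i) (rfl : Subgroup.centralizer ({γc T i} : Set (Gqs L v)) = _))
    have hfκ : IntegrableOn (fun y => f y * ∑ᶠ t : ↥(Subgroup.centralizer ({γc T i} : Set (Gqs L v))), {t' : ↥(Subgroup.centralizer ({γc T i} : Set (Gqs L v))) | IsConj ((t' : Gqs L v)) y}.indicator K t)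
        {x | ∃ g t : Gqs L v, t ∈ Subgroup.centralizer ({γc T i} : Set (Gqs L v)) ∧ IsRegularElt (t.val : GL (Fin 3) (UnitaryGroup.LocalRing L v)) ∧ g * t * g⁻¹ = x} νQv := by
      have h1 := (hIntG T hT i).integrableOn (s := {x | ∃ g t : Gqs L v, t ∈ Subgroup.centralizer ({γc T i} : Set (Gqs L v)) ∧
        IsRegularElt (t.val : GL (Fin 3) (UnitaryGroup.LocalRing L v)) ∧ g * t * g⁻¹ = x})
      refine h1.congr_fun (fun y _ => ?_) (measurableSet_cartanSet (hγc T hT i) rfl Φ' hΦ' hns)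
      simp only [horb y]
    have htrans := integrableOn_and_setIntegral_comp_embedding L v hns (tH T) (htH T hT) (rfl : Subgroup.centralizer ({γc T i} : Set (Gqs L v)) = _) tT htT1
      (eT T i) (heT T hT i)
      (fun t => ((NNReal.sqrt ((∏ w : PlacesOver L v, IsNonarchimedeanLocalField.normAbs (w.1.adicCompletion L) (((((t : Gqs L v)).val : GL (Fin 3) (UnitaryGroup.LocalRing L v)).val.charpoly.discr) w)) * ((∏ w : PlacesOver L v, IsNonarchimedeanLocalField.normAbs (w.1.adicCompletion L) (((((t : Gqs L v)).val : GL (Fin 3) (UnitaryGroup.LocalRing L v)).val.det) w)) ^ 2)⁻¹) : ℝ≥0) : ℝ) • (K t * classOrbitalIntegral mQv f (ConjClasses.mk (t : Gqs L v))))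
    have hK : IntegrableOn (fun t : ↥(Subgroup.centralizer ({γc T i} : Set (Gqs L v))) => ((NNReal.sqrt ((∏ w : PlacesOver L v, IsNonarchimedeanLocalField.normAbs (w.1.adicCompletion L) (((((t : Gqs L v)).val : GL (Fin 3) (UnitaryGroup.LocalRing L v)).val.charpoly.discr) w)) * ((∏ w : PlacesOver L v, IsNonarchimedeanLocalField.normAbs (w.1.adicCompletion L) (((((t : Gqs L v)).val : GL (Fin 3) (UnitaryGroup.LocalRing L v)).val.det) w)) ^ 2)⁻¹) : ℝ≥0) : ℝ) •
        (K t * classOrbitalIntegral mQv f (ConjClasses.mk (t : Gqs L v))))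
        {t | IsRegularElt (((t : Gqs L v)).val : GL (Fin 3) (UnitaryGroup.LocalRing L v))} tT := by
      rw [htrans.1]
      refine (hIntT T hT i).congr_fun (fun s _ => ?_) hTm
      simp only [hKe]
    -- ★ (A1′)-D EXCHANGE
    have hex := setIntegral_mul_orbitSum_embedding_eq L v hns νQv hcanQ (tH T) (htH T hT) (hγc T hT i) rfl tT htT1 (eT T i) (heT T hT i) f hf K hfκ hK
    -- the pointwise weight identity on `T^{G-reg}`: `√radicand(e s) • (K(e s) · O) = dG(e s) · (τ dH κ α)(s) · O`
    have hwt : ∀ s ∈ {s : ↥T | IsLocalGRegular L v (s : ((UnitaryGroup.cmDatum L 2 (Matrix.of fun i j : Fin 2 => if i.val + j.val + 1 = 2 then (1 : L) else 0)).Local v × (UnitaryGroup.cmDatum L 1 (Matrix.of fun i j : Fin 1 => if i.val + j.val + 1 = 1 then (1 : L) else 0)).Local v))},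
        ((NNReal.sqrt ((∏ w : PlacesOver L v, IsNonarchimedeanLocalField.normAbs (w.1.adicCompletion L) ((((((eT T i s : ↥(Subgroup.centralizer ({γc T i} : Set (Gqs L v)))) : Gqs L v)).val : GL (Fin 3) (UnitaryGroup.LocalRing L v)).val.charpoly.discr) w)) * ((∏ w : PlacesOver L v, IsNonarchimedeanLocalField.normAbs (w.1.adicCompletion L) ((((((eT T i s : ↥(Subgroup.centralizer ({γc T i} : Set (Gqs L v)))) : Gqs L v)).val : GL (Fin 3) (UnitaryGroup.LocalRing L v)).val.det) w)) ^ 2)⁻¹) : ℝ≥0) : ℝ) • (K (eT T i s) * classOrbitalIntegral mQv f (ConjClasses.mk ((eT T i s : ↥(Subgroup.centralizer ({γc T i} : Set (Gqs L v)))) : Gqs L v))) =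
          (dG ((eT T i s : ↥(Subgroup.centralizer ({γc T i} : Set (Gqs L v)))) : Gqs L v) : ℂ) * (finTau L v s.1 μ * (dH s.1 : ℂ) * ((finKappaAt L v (qsForm L) s.1 ((eT T i s : ↥(Subgroup.centralizer ({γc T i} : Set (Gqs L v)))) : Gqs L v) : ℤ) : ℂ) * α s.1) *
            classOrbitalIntegral mQv f (ConjClasses.mk ((eT T i s : ↥(Subgroup.centralizer ({γc T i} : Set (Gqs L v)))) : Gqs L v)) := by
      intro s hs
      rw [Set.mem_setOf_eq] at hs
      have hreg : IsRegularElt ((((eT T i s : ↥(Subgroup.centralizer ({γc T i} : Set (Gqs L v)))) : Gqs L v)).val : GL (Fin 3) (UnitaryGroup.LocalRing L v)) :=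
        (isLocalGRegular_iff_isRegularElt_of_isLocalNormPair L v (heT T hT i s)).1 hs
      have hKs : K (eT T i s) = ((dG ((eT T i s : ↥(Subgroup.centralizer ({γc T i} : Set (Gqs L v)))) : Gqs L v) : ℂ))⁻¹ * (finTau L v s.1 μ * (dH s.1 : ℂ) * ((finKappaAt L v (qsForm L) s.1 ((eT T i s : ↥(Subgroup.centralizer ({γc T i} : Set (Gqs L v)))) : Gqs L v) : ℤ) : ℂ) * α s.1) := by
        rw [hKe]
        exact congrArg (· * (finTau L v s.1 μ * (dH s.1 : ℂ) * ((finKappaAt L v (qsForm L) s.1 ((eT T i s : ↥(Subgroup.centralizer ({γc T i} : Set (Gqs L v)))) : Gqs L v) : ℤ) : ℂ) * α s.1)) (if_pos hreg)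
      have hsq : (((NNReal.sqrt ((∏ w : PlacesOver L v, IsNonarchimedeanLocalField.normAbs (w.1.adicCompletion L) ((((((eT T i s : ↥(Subgroup.centralizer ({γc T i} : Set (Gqs L v)))) : Gqs L v)).val : GL (Fin 3) (UnitaryGroup.LocalRing L v)).val.charpoly.discr) w)) * ((∏ w : PlacesOver L v, IsNonarchimedeanLocalField.normAbs (w.1.adicCompletion L) ((((((eT T i s : ↥(Subgroup.centralizer ({γc T i} : Set (Gqs L v)))) : Gqs L v)).val : GL (Fin 3) (UnitaryGroup.LocalRing L v)).val.det) w)) ^ 2)⁻¹) : ℝ≥0) : ℝ) : ℂ) = (dG ((eT T i s : ↥(Subgroup.centralizer ({γc T i} : Set (Gqs L v)))) : Gqs L v) : ℂ) * (dG ((eT T i s : ↥(Subgroup.centralizer ({γc T i} : Set (Gqs L v)))) : Gqs L v) : ℂ) := by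
        rw [hdGsq _ hreg, Complex.ofReal_mul]
      rw [Complex.real_smul, hsq, hKs]
      rw [show (dG ((eT T i s : ↥(Subgroup.centralizer ({γc T i} : Set (Gqs L v)))) : Gqs L v) : ℂ) * (dG ((eT T i s : ↥(Subgroup.centralizer ({γc T i} : Set (Gqs L v)))) : Gqs L v) : ℂ) * (((dG ((eT T i s : ↥(Subgroup.centralizer ({γc T i} : Set (Gqs L v)))) : Gqs L v) : ℂ))⁻¹ *
          (finTau L v s.1 μ * (dH s.1 : ℂ) * ((finKappaAt L v (qsForm L) s.1 ((eT T i s : ↥(Subgroup.centralizer ({γc T i} : Set (Gqs L v)))) : Gqs L v) : ℤ) : ℂ) * α s.1) * classOrbitalIntegral mQv f (ConjClasses.mk ((eT T i s : ↥(Subgroup.centralizer ({γc T i} : Set (Gqs L v)))) : Gqs L v))) =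
          ((dG ((eT T i s : ↥(Subgroup.centralizer ({γc T i} : Set (Gqs L v)))) : Gqs L v) : ℂ) * (dG ((eT T i s : ↥(Subgroup.centralizer ({γc T i} : Set (Gqs L v)))) : Gqs L v) : ℂ) * ((dG ((eT T i s : ↥(Subgroup.centralizer ({γc T i} : Set (Gqs L v)))) : Gqs L v) : ℂ))⁻¹) *
          ((finTau L v s.1 μ * (dH s.1 : ℂ) * ((finKappaAt L v (qsForm L) s.1 ((eT T i s : ↥(Subgroup.centralizer ({γc T i} : Set (Gqs L v)))) : Gqs L v) : ℤ) : ℂ) * α s.1) * classOrbitalIntegral mQv f (ConjClasses.mk ((eT T i s : ↥(Subgroup.centralizer ({γc T i} : Set (Gqs L v)))) : Gqs L v))) by ring,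
        mul_self_mul_inv]
      ring
    refine ⟨?_, ?_⟩
    · calc ∫ y in {g : Gqs L v | IsRegularElt (g.val : GL (Fin 3) (UnitaryGroup.LocalRing L v))}, f y *
              ∑ᶠ s : ↥T, {s' : ↥T | IsConj (((eT T i s' : ↥(Subgroup.centralizer ({γc T i} : Set (Gqs L v)))) : Gqs L v)) y}.indicator (fun s : ↥T => (if IsRegularElt ((((eT T i s : ↥(Subgroup.centralizer ({γc T i} : Set (Gqs L v)))) : Gqs L v)).val : GL (Fin 3) (UnitaryGroup.LocalRing L v)) then ((dG ((eT T i s : ↥(Subgroup.centralizer ({γc T i} : Set (Gqs L v)))) : Gqs L v) : ℂ))⁻¹ else 0) * (finTau L v s.1 μ * (dH s.1 : ℂ) * ((finKappaAt L v (qsForm L) s.1 ((eT T i s : ↥(Subgroup.centralizer ({γc T i} : Set (Gqs L v)))) : Gqs L v) : ℤ) : ℂ) * α s.1)) s ∂νQv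
          = ∫ y in {g : Gqs L v | IsRegularElt (g.val : GL (Fin 3) (UnitaryGroup.LocalRing L v))}, f y *
              ∑ᶠ t : ↥(Subgroup.centralizer ({γc T i} : Set (Gqs L v))), {t' : ↥(Subgroup.centralizer ({γc T i} : Set (Gqs L v))) | IsConj ((t' : Gqs L v)) y}.indicator K t ∂νQv := by
            refine setIntegral_congr_fun hGm fun y _ => ?_
            simp only [horb y]
        _ = _ := hloc
        _ = _ := hex
        _ = _ := setIntegral_congr_fun hTm hwt
    · have hI : IntegrableOn (fun s : ↥T => ((NNReal.sqrt ((∏ w : PlacesOver L v, IsNonarchimedeanLocalField.normAbs (w.1.adicCompletion L) ((((((eT T i s : ↥(Subgroup.centralizer ({γc T i} : Set (Gqs L v)))) : Gqs L v)).val : GL (Fin 3) (UnitaryGroup.LocalRing L v)).val.charpoly.discr) w)) * ((∏ w : PlacesOver L v, IsNonarchimedeanLocalField.normAbs (w.1.adicCompletion L) ((((((eT T i s : ↥(Subgroup.centralizer ({γc T i} : Set (Gqs L v)))) : Gqs L v)).val : GL (Fin 3) (UnitaryGroup.LocalRing L v)).val.det) w)) ^ 2)⁻¹) : ℝ≥0)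 : ℝ) • (K (eT T i s) * classOrbitalIntegral mQv f (ConjClasses.mk ((eT T i s : ↥(Subgroup.centralizer ({γc T i} : Set (Gqs L v)))) : Gqs L v)))) {s : ↥T | IsLocalGRegular L v (s : ((UnitaryGroup.cmDatum L 2 (Matrix.of fun i j : Fin 2 => if i.val + j.val + 1 = 2 then (1 : L) else 0)).Local v × (UnitaryGroup.cmDatum L 1 (Matrix.of fun i j : Fin 1 => if i.val + j.val + 1 = 1 then (1 : L) else 0)).Local v))} (tH T) :=
        (hIntT T hT i).congr_fun (fun s _ => by simp only [hKe]) hTm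
      exact hI.congr_fun hwt hTm
  -- sum the pieces over `i`, exchange `Σ_i` and `∫_T` ((A0)(ii)), then (P2)
  rw [Finset.sum_congr rfl fun i _ => (hpiece i).1, ← integral_finsetSum _ fun i _ => (hpiece i).2]
  exact setIntegral_congr_fun hTm fun s hs => hP2 T hT s hs


end CM

end Summit.HodgeConjecture.HodgeConjecture.Cruxes.H413.F0P3cStCharTSUpTrAssemblyCoreSH

end
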